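import Mathlib
import Summits.NavierStokesRegularity.NavierStokesRegularity.Theorems.EulerZoomLiouvillePowerGaugeEulerLiouvilleCondenserWeightedQuietSlice

/-!
# (Q_T) THE `s²`-WEIGHTED QUIET SLICE ON A PRESCRIBED SET OF HEIGHTS (ref3 SCORE-p2-ROUND-45 F5; nsreg-p2 ROUND-45 §3)

Width piece for crux `EulerZoomLiouville.PowerGaugeEulerLiouville` (stmt-NavierStokesRegularity-19832), by name under LEAD 19832
(ns-typeII-p2 g13); seat ns-ezl-w2 g4, `--supports stmt-NavierStokesRegularity-19832 --as helper`.

The (Q) slice of plate t47-Q (`Condenser.weightedQuietSlice_of`) chosen INSIDE a prescribed measurable set of heights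
`T ⊆ [R, ΛR]` of measure `≥ (1−η′)(Λ−1)R` (e.g. the heights at which the first hits of `N` orbit segments are `2r`-separated —
the weak-separation form of THEOREM P asked for by ref3's F5): `F, G ≥ 0` continuous, `∫_{B(0,R')} F ≤ X`, `∫_{B(0,R')} G ≤ Y`,
`Λ > 1`, `0 < η`, `η + η′ < 1` (no sign condition on `η′`) ⇒ some height `s ∈ T` has
`∫ 𝟙_{B(0,R')}F ∘ plane s ≤ X/(η(Λ−1)R)` AND `∫ 𝟙_{B(0,R')}G ∘ plane s ≤ 3Y s²/(((1+(1−η−η′)(Λ−1))³ − 1)R³)`.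
Proof: Markov for `F` on `[R, ΛR]` removes a set of heights of measure `≤ η(Λ−1)R`; the good part of `T` has measure
`≥ (1−η−η′)(Λ−1)R`; if on it every `G`-slice exceeded `λ s²`, the BATHTUB principle (`setIntegral_sq_ge_bathtub`) would give
`∫ G`-slices `> λ·∫_R^{R+(1−η−η′)(Λ−1)R} s² ds = Y`.  With `η′ = 0`, `T = [R, ΛR]` this is (Q) (`weightedQuietSlice_of`, same constants).

HONEST FRAMING: measure theory on coordinate slices of `ℝ³`; nothing here proves the crux E (19832 OPEN), any door Target, or any
Navier–Stokes statement; MODEL lattice only. [folklore (Markov, bathtub principle)]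
-/

noncomputable section

open Set Filter Topology Metric Function MeasureTheory Real

set_option linter.dupNamespace false

namespace Summit.NavierStokesRegularity.NavierStokesRegularity.Theorems.PowerGaugeEulerLiouville.Condenser

/-- **(Q_T) THE `s²`-WEIGHTED QUIET SLICE ON A PRESCRIBED SET OF HEIGHTS.**  See the module docstring.
[folklore (Markov, bathtub principle)] -/
theorem weightedQuietSlice_on {F G : EuclideanSpace ℝ (Fin 3) → ℝ} (hFc : Continuous F) (hGc : Continuous G)
    (hF0 : ∀ x, 0 ≤ F x) (hG0 : ∀ x, 0 ≤ G x) {R Λ R' η η' X Y : ℝ} (hR : 0 < R) (hΛ : 1 < Λ) (hη : 0 < η)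
    (hηη' : η + η' < 1) (hX : 0 < X) (hY : 0 < Y)
    (hFX : ∫ x in ball (0 : EuclideanSpace ℝ (Fin 3)) R', F x ≤ X)
    (hGY : ∫ x in ball (0 : EuclideanSpace ℝ (Fin 3)) R', G x ≤ Y)
    {T : Set ℝ} (hTm : MeasurableSet T) (hTJ : T ⊆ Icc R (Λ * R)) (hTvol : (1 - η') * ((Λ - 1) * R) ≤ volume.real T) :
    ∃ s ∈ T,
      ∫ a, (ball (0 : EuclideanSpace ℝ (Fin 3)) R').indicator F (plane s a) ≤ X / (η * (Λ - 1) * R) ∧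
      ∫ a, (ball (0 : EuclideanSpace ℝ (Fin 3)) R').indicator G (plane s a) ≤
        3 * Y / (((1 + (1 - η - η') * (Λ - 1)) ^ 3 - 1) * R ^ 3) * s ^ 2 := by
  set hF : ℝ → ℝ := fun s => ∫ a, (ball (0 : EuclideanSpace ℝ (Fin 3)) R').indicator F (plane s a) with hhF
  set hG : ℝ → ℝ := fun s => ∫ a, (ball (0 : EuclideanSpace ℝ (Fin 3)) R').indicator G (plane s a) with hhG
  have hFint : Integrable hF := integrable_integral_plane _ (integrable_indicator_ball_of_continuous hFc R')
  have hGint : Integrable hG := integrable_integral_plane _ (integrable_indicator_ball_of_continuous hGc R')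
  have hFnn : ∀ s, 0 ≤ hF s := fun s => integral_indicator_plane_nonneg hF0 R' s
  have hGnn : ∀ s, 0 ≤ hG s := fun s => integral_indicator_plane_nonneg hG0 R' s
  have hFtot : ∫ s, hF s ≤ X := by rw [hhF, integral_integral_indicator_plane hFc R']; exact hFX
  have hGtot : ∫ s, hG s ≤ Y := by rw [hhG, integral_integral_indicator_plane hGc R']; exact hGY
  have hΛ1 : 0 < Λ - 1 := by linarith
  set μ₀ : ℝ := (1 - η - η') * (Λ - 1) * R with hμ₀
  have hμ₀pos : 0 < μ₀ := by rw [hμ₀]; exact mul_pos (mul_pos (by linarith) hΛ1) hR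
  set tF : ℝ := X / (η * (Λ - 1) * R) with htF
  have htFpos : 0 < tF := by rw [htF]; positivity
  -- Markov for `F` on `[R, ΛR]`
  set J : Set ℝ := Icc R (Λ * R) with hJ
  have hJm : MeasurableSet J := measurableSet_Icc
  have hJfin : volume J ≠ ⊤ := measure_Icc_lt_top.ne
  have hBad : volume.real ({s | tF ≤ hF s} ∩ J) ≤ η * (Λ - 1) * R := by
    have hM := mul_meas_ge_le_integral_of_nonneg (μ := volume.restrict J) (ae_of_all _ hFnn) hFint.restrict tF
    have hset : ∫ s in J, hF s ≤ X := (setIntegral_le_integral hFint (ae_of_all _ hFnn)).trans hFtot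
    rw [measureReal_restrict_apply' hJm] at hM
    have hle : tF * volume.real ({s | tF ≤ hF s} ∩ J) ≤ X := hM.trans hset
    have e : X = tF * (η * (Λ - 1) * R) := by rw [htF]; field_simp
    rw [e] at hle
    exact le_of_mul_le_mul_left hle htFpos
  -- measurability of the slice functions
  have hmeas : ∀ {Φ : EuclideanSpace ℝ (Fin 3) → ℝ}, Continuous Φ →
      Measurable fun s => ∫ a, (ball (0 : EuclideanSpace ℝ (Fin 3)) R').indicator Φ (plane s a) := by
    intro Φ hΦ
    have hH : Measurable ((ball (0 : EuclideanSpace ℝ (Fin 3)) R').indicator Φ) := hΦ.measurable.indicator measurableSet_ball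
    have h1 : StronglyMeasurable (uncurry fun (s : ℝ) (a : EuclideanSpace ℝ (Fin 2)) =>
        (ball (0 : EuclideanSpace ℝ (Fin 3)) R').indicator Φ (plane s a)) := by
      have e : (uncurry fun (s : ℝ) (a : EuclideanSpace ℝ (Fin 2)) =>
          (ball (0 : EuclideanSpace ℝ (Fin 3)) R').indicator Φ (plane s a)) =
          fun p => (ball (0 : EuclideanSpace ℝ (Fin 3)) R').indicator Φ (planeEquiv.symm p) := by
        funext p; rw [uncurry, ← planeEquiv_symm_apply]
      rw [e]; exact (hH.comp planeEquiv.symm.measurable).stronglyMeasurable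
    exact (h1.integral_prod_right (ν := volume)).measurable
  have hFm : Measurable hF := hmeas hFc
  -- the good part of `T`
  set S : Set ℝ := T ∩ {s | hF s < tF} with hSdef
  have hSm : MeasurableSet S := hTm.inter (measurableSet_lt hFm measurable_const)
  have hST : S ⊆ T := inter_subset_left
  have hSJ : S ⊆ J := hST.trans hTJ
  have hTfin : volume T ≠ ⊤ := (measure_mono hTJ |>.trans_lt measure_Icc_lt_top).ne
  have hSvol : μ₀ ≤ volume.real S := by
    have hsplit := measureReal_inter_add_sdiff (μ := volume) (s := T) (t := {s | tF ≤ hF s})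
      (measurableSet_le measurable_const hFm) hTfin
    have e2 : T \ {s | tF ≤ hF s} = S := by
      ext s
      simp only [hSdef, Set.mem_sdiff, mem_inter_iff, mem_setOf_eq, not_le]
    have hmono : volume.real (T ∩ {s | tF ≤ hF s}) ≤ volume.real ({s | tF ≤ hF s} ∩ J) :=
      measureReal_mono (fun s hs => ⟨hs.2, hTJ hs.1⟩) (measure_ne_top_of_subset inter_subset_right hJfin)
    rw [e2] at hsplit
    rw [hμ₀]
    nlinarith [hBad, hsplit, hmono, hTvol]
  -- the `G`-threshold
  set lam : ℝ := 3 * Y / (((1 + (1 - η - η') * (Λ - 1)) ^ 3 - 1) * R ^ 3) with hlam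
  have hbase : 1 < 1 + (1 - η - η') * (Λ - 1) := by nlinarith
  have hden : 0 < ((1 + (1 - η - η') * (Λ - 1)) ^ 3 - 1) * R ^ 3 := by
    have : 1 < (1 + (1 - η - η') * (Λ - 1)) ^ 3 := by
      have h2 := pow_lt_pow_left₀ hbase zero_le_one (n := 3) (by norm_num)
      rwa [one_pow] at h2
    have : 0 < R ^ 3 := by positivity
    nlinarith
  have hlampos : 0 < lam := by rw [hlam]; positivity
  -- bathtub: `lam · ∫_S s² ≥ Y`
  have hbath := setIntegral_sq_ge_bathtub hR.le hμ₀pos.le hSm hSJ hSvol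
  have hIcc : ∫ s in Icc R (R + μ₀), s ^ 2 = ((R + μ₀) ^ 3 - R ^ 3) / 3 := by
    rw [integral_Icc_eq_integral_Ioc, ← intervalIntegral.integral_of_le (by linarith), integral_pow]; norm_num
  have hkey : Y ≤ lam * ∫ s in S, s ^ 2 := by
    have e : lam * (((R + μ₀) ^ 3 - R ^ 3) / 3) = Y := by
      have hden' := ne_of_gt hden
      rw [hlam, hμ₀]
      have e3 : (R + (1 - η - η') * (Λ - 1) * R) ^ 3 - R ^ 3 = (((1 + (1 - η - η') * (Λ - 1)) ^ 3 - 1) * R ^ 3) := by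
        ring
      rw [e3]
      have hb3 : (1 + (1 - η - η') * (Λ - 1)) ^ 3 - 1 ≠ 0 := by
        intro h0; rw [h0, zero_mul] at hden'; exact hden' rfl
      field_simp
    calc Y = lam * (((R + μ₀) ^ 3 - R ^ 3) / 3) := e.symm
      _ = lam * ∫ s in Icc R (R + μ₀), s ^ 2 := by rw [hIcc]
      _ ≤ lam * ∫ s in S, s ^ 2 := mul_le_mul_of_nonneg_left hbath hlampos.le
  -- conclusion by contradiction
  by_contra hcon
  push Not at hcon
  have hstrict : ∀ s ∈ S, lam * s ^ 2 < hG s := by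
    intro s hs
    have hFs : hF s ≤ tF := le_of_lt hs.2
    exact hcon s (hST hs) hFs
  have hi2 : IntegrableOn (fun s : ℝ => lam * s ^ 2) S volume :=
    ((continuous_const.mul (continuous_id.pow 2) : Continuous fun s : ℝ => lam * s ^ 2).continuousOn.integrableOn_compact
      isCompact_Icc).mono_set hSJ
  have hintS : IntegrableOn (fun s => hG s - lam * s ^ 2) S volume := (hGint.integrableOn).sub hi2
  have hpos : 0 < ∫ s in S, (hG s - lam * s ^ 2) := by
    rw [setIntegral_pos_iff_support_of_nonneg_ae ?_ hintS]
    · have hSsub : S ⊆ support (fun s => hG s - lam * s ^ 2) ∩ S := fun s hs =>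
        ⟨Function.mem_support.2 (ne_of_gt (sub_pos.2 (hstrict s hs))), hs⟩
      have hSpos : 0 < volume S := by
        have h := hSvol
        rw [measureReal_def] at h
        exact ENNReal.toReal_pos_iff.1 (hμ₀pos.trans_le h) |>.1
      exact hSpos.trans_le (measure_mono hSsub)
    · filter_upwards [ae_restrict_mem hSm] with s hs
      exact (sub_pos.2 (hstrict s hs)).le
  have hsplit : ∫ s in S, (hG s - lam * s ^ 2) = (∫ s in S, hG s) - lam * ∫ s in S, s ^ 2 := by
    rw [integral_sub hGint.integrableOn hi2, integral_const_mul]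
  have hGS : ∫ s in S, hG s ≤ Y := (setIntegral_le_integral hGint (ae_of_all _ hGnn)).trans hGtot
  rw [hsplit] at hpos
  linarith

end Summit.NavierStokesRegularity.NavierStokesRegularity.Theorems.PowerGaugeEulerLiouville.Condenser

end
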